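import Literature.MathematicalPhysics.QuantumFieldTheory.Balaban1983to89.B3Eq18VertexExpansion
import Literature.MathematicalPhysics.QuantumFieldTheory.Balaban1983to89.B3Eq15ChargeDerivative
import Literature.MathematicalPhysics.QuantumFieldTheory.Balaban1983to89.B3Prop1

/-!
# `Balaban1983to89.B3Eq114AveragingVertices` — T. Bałaban, *(Higgs)₂,₃ quantum fields in a finite volume. III.
Renormalization*, Commun. Math. Phys. **88** (1983) 411–445 [Balaban1983Higgs3], pp. 413–414 [PDF 3–4], the expressions
**(1.12)–(1.15)** of the perturbation expansion AS ANALYTIC EXPRESSIONS on the concrete `HiggsLattice` carriers, the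
sentence *"The remaining vertices are connected with the expansion of the renormalization transformation for scalar
fields"* (p. 413) as a KERNEL THEOREM — (1.13), (1.14), (1.15) are, block point by block point and with the printed
numerical factors, the `e′`-Taylor coefficients of `−(Q_k(B̃ + e′A′ + Ã)φ′)(y)` with the small field expanded by (I.3.14)
to the order `n̄` — and the PAIRING RULE of p. 414 (*"we take their scalar product. We multiply it by −a_k if the
expressions are different, or by −½a_k if they are equal"*) as the finite algebraic identity it is; companion of
`B3Eq18VertexExpansion` ((1.6)–(1.11))

statement-level skeleton of published theorems with citation tags; proofs where landed; nothing here is a claim about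
the Yang–Mills mass gap

PDFs held: `paper:balaban1983-higgs-2-3-quantum-fields-finite-volume` (journal page = PDF page + 410; pp. 412–414 read on
the ×2 renders `run/shared/lean/pub/pub-balaban/b2b-balaban-ref1/pages/1983-cmp88-higgs23-III/1983-cmp88-higgs23-III-p002…p004-x2.png`,
never from the OCR layer) and `paper:balaban1982-cmp85-higgs23-i` (journal page = PDF page + 602; (2.11) p. 609,
(3.14)–(3.15) p. 614).

CITATION HEADER (lean-in-tree rule).  lit-balaban TYPED SKELETON (HOME `run/shared/lean/pub/lit-balaban/`), row
**B3.Eq1.12-1.15** (owner r15, `lit-balaban-r15/ROWS-B3.md`; head `typed p238938` = `B3Prop1.VertexKind` at DATA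
level).  LOCATED MEMBER of that row (no head claim; cells are the owner's).  Unit `lit-balaban-typer` gen 29
(literature-prover-lit-balaban-typer-g29-0).  Carriers: `HiggsLattice` (p239040), `HiggsAveraging.blockK` (p239768),
r15's `B3MultiscaleFields` ((1.3), `etaSumK`, `holK13`) and `B3VertexTensorBounds` (`taylorRemOp` = `R_{n̄+1}`,
(I.3.14) `exp_eq_taylor_sum_add'`), the typer's `B3Eq14AuxFunction.Data14.avgQ14` / `B3Eq15ChargeDerivative.fluctContour`.

THE SOURCE TEXT (pp. 413–414, displays read on the renders; `η = L^{−k}`, `Γ = Γ^{(k)}_{y,x}`): *"The remaining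
vertices are connected with the expansion of the renormalization transformation for scalar fields. The expressions we
get have always two summations over the η-lattice, so it is convenient to represent them by two vertices. Thus we will
have* `φ(y), y ∈ T₁^{(k)} ∩ Ω,` (1.12) `−(Q_k(B̃)φ′)(y) = −Σ_{x∈B^k(y)} η^d U(B̃(Γ^{(k)}_{y,x}))φ′(x),` (1.13)
`−(e(L^kε))^{n+n′} (1/(n!n′!)) Σ_{x∈B^k(y)} η^d (A′(Γ^{(k)}_{y,x}))^n (Ã(Γ^{(k)}_{y,x}))^{n′} q^{n+n′} U(B̃(Γ^{(k)}_{y,x}))φ′(x),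
n, n′ ≦ n̄, n + n′ ≧ 1,` (1.14) *and the R-vertices*
`−(e(L^kε))^{n+n̄+1} (1/(n!(n̄+1)!)) Σ_{x∈B^k(y)} η^d (A′(Γ^{(k)}_{y,x}))^n (Ã(Γ^{(k)}_{y,x}))^{n̄+1}
· q^{n+n̄+1} R_{n̄+1}(qe(L^kε)Ã(Γ^{(k)}_{y,x})) U(B̃(Γ^{(k)}_{y,x}))φ′(x), n ≦ n̄.` (1.15) *Now the expressions of the
expansion are formed in the following way: we take an arbitrary pair of two expressions from (1.12)–(1.15), with the
restriction that at least one of them has to be of the form (1.14) or (1.15), and we take their scalar product. We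
multiply it by −a_k if the expressions are different, or by −½a_k if they are equal, and finally we sum over
y ∈ T₁^{(k)} ∩ Ω. In the sequel we will treat (1.13)–(1.15) as the vertices, and (1.12) is an external field. … Let us
notice that the vertices of (1.5) are given by (1.6)–(1.8), (1.10), (1.13), and (1.14) with n′ = 0 and B̃ = A^{(k)}."*;
p. 412: *"For an arbitrary vector field A defined on η-lattice and an arbitrary contour Γ of this lattice we put
A(Γ) = Σ_{b⊂Γ} ηA_b"*; [Balaban1982Higgs1] (2.11) p. 609: *"(Q_k(A)φ)(y) = Σ_{x∈B^k(y)} L^{−kd} U(A(Γ^{(k)}_{y,x}))φ(x)"*;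
(3.15) p. 614 (the expansion of `Q_k(A + B)` by (3.14)).

THE ARGUMENT (ours).  `U` is a one-parameter group: `U((B̃ + e′A′ + Ã)(Γ)) = exp(e′·eA′(Γ)q) exp(eÃ(Γ)q) U(B̃(Γ))`.
The `n`-th `e′`-derivative at `0` of the first factor is `(eA′(Γ)q)^n`; the second factor is expanded by (I.3.14) to the
order `n̄` with the remainder `R_{n̄+1}(qeÃ(Γ))`; multiplying out and summing over `x ∈ B^k(y)` with the weight gives, for
the coefficient of `e′^n/n!` of `−(Q_k(B̃+e′A′+Ã)φ′)(y)`, the terms `n′ ≦ n̄` of (1.14)_{n,·} plus (1.15)_n, the term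
`n = n′ = 0` being (1.13).  The quadratic form `−½a_k|φ(y) − (Q_kφ′)(y)|²` of the renormalization transformation
(I.2.10), with `φ(y) − (Q_kφ′)(y)` the sum of the expressions, is the sum over unordered pairs of the products — print's
rule; the pairs inside {(1.12), (1.13)} reassemble the unperturbed `−½a_k|φ(y) − (Q_k(B̃)φ′)(y)|²`.

WHAT IS TYPED / PROVED (definitions with bodies + theorems; no `Prop` fact; axioms standard).  Parameters: charge datum
`C` (`C.e` = `e(L^kε)`), a weight `w` (print: `η^d`; the tree's (I.2.11)/`avgQ14` carries `L^{−kd}`, the same number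
when `η = L^{−k}`), the contour functionals `β x = B̃(Γ^{(k)}_{y,x})`, `α x = A′(Γ^{(k)}_{y,x})`, `τ x = Ã(Γ^{(k)}_{y,x})`
of the three fields (print: `Σ_{b⊂Γ}ηA_b`, the tree's `B3MultiscaleFields.etaSumK`; for the typed (1.4) the
fluctuation functional is the multiscale (1.3) reading `B3Eq15ChargeDerivative.Data14.fluctContour`), the old field `φ′`:
* §1 `vertex112`, `vertex113`, `vertex114`, `vertex115` ((1.12)–(1.15) with the printed factors), `avgTerm`
  (`e′ ↦ −(Q_k(B̃+e′A′+Ã)φ′)(y)`), `vertex114_zero_zero` ((1.14)_{0,0} is (1.13));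
* §2 `U_one_contour` (`U(β + e′α + τ) = exp(e′Y)exp(Z)U(β)`), all `e′`-derivatives of `avgTerm` in closed form
  (`iteratedDeriv_avgTerm`), `smul_q_pow_mul_exp` ((I.3.14) multiplied out);
* §3 **`taylorCoeff_avgTerm`** — `(1/n!)∂ⁿ_{e′}|₀ avgTerm = [n=0]·(1.13) + Σ_{n′≦n̄, n+n′≧1}(1.14)_{n,n′} + (1.15)_n` for
  every `n`, `n̄`, `y`; `taylorCoeff_avgTerm_noSmallField` (`Ã = 0`: only (1.14)_{n,0}, p. 414 *"with n′ = 0"*);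
* §4 the pairing rule: **`pairing_rule`** (`−½a|Σ_iT_i|² = Σ_i(−½a)|T_i|² + Σ_{i<j}(−a)⟨T_i,T_j⟩` for every finite
  linearly ordered family of vectors of `ℝ^N`) and `pairing_base` (the pairs inside {(1.12),(1.13)} give
  `−½a|φ(y) − (Q_k(B̃)φ′)(y)|²`);
* §5 the typed (1.4): `neg_avgQ14_eq_avgTerm` (`−(Q_k(e′g_k𝒜 + Ã + B̃)φ′)(y)` of `Data14.avgQ14` IS `avgTerm` with
  `w = L^{−kd}`, `β = B̃(Γ)`, `α = fluctContour`, `τ = Ã(Γ)`), **`taylorCoeff_avgQ14`**, and at `A^{(k)} = B̃` alone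
  **`taylorCoeff_avgQ14_noSmallField`** (p. 414: *"(1.13), and (1.14) with n′ = 0 and B̃ = A^{(k)}"*).
* §6 (v1.1, append-only, same unit): the pairing rule AT THE LEVEL OF THE `e′`-TAYLOR COEFFICIENTS (Leibniz):
  `totalDeriv` (the derivative chain of (1.12) + `avgTerm`), `coeffExpr m` (`= [m=0]·((1.12)+(1.13)) +
  Σ_{n′≦n̄, m+n′≧1}(1.14)_{m,n′} + (1.15)_m`, `coeffExpr_eq`), **`pairing_taylorCoeff`**:
  `(1/n!)·∂ⁿ_{e′}|₀(−½a|φ(y) − (Q_k(B̃+e′A′+Ã)φ′)(y)|²) = −½a Σ_{i+j=n}⟨E_i, E_j⟩` — the scalar products of the pairs of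
  expressions whose `A′`-orders add up to `n` (Mathlib's Pascal identity `Finset.sum_antidiagonal_choose_succ_mul`).
* §7 (v1.1) DATA BRIDGE to the token of record `B3Prop1.VertexKind` (p238938; the row owner's precision): (1.13)–(1.15)
  are homogeneous of degree `scalarLegs = 1` in `φ′` (`vertex113/114/115_smul_field`), `vectorLegs = n` in the `A′`-functional
  (`vertex114/115_smul_fluct`), `extVectorLegs = n′` in the `Ã`-functional for (1.14) (`vertex114_smul_ext`; (1.15) is not
  homogeneous in `Ã`), carry `e(L^kε)^{dv}` (`vertex114/115_eq_dv`); print's side conditions = `VertexKind.Admissible` = the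
  index ranges of `taylorCoeff_avgTerm` (`admissible114_iff`, `admissible113_115`); `tags_catalogue`.
* §8 (v1.2, append-only) *"and finally we sum over y ∈ T₁^{(k)} ∩ Ω"* for the typed kernel `Data14.kernel14`:
  `log_kernel14_eq` (log t(Ω;φ,φ′) = normalization + Σ_y (−½κ)|(1.12) + avgTerm(e′)|², κ = a_k(L^kη)^{d−2}) and
  **`taylorCoeff_log_kernel14`** (its `e′`-Taylor coefficients = Σ_y of the pairings `pairing_taylorCoeff`).
HONEST SCOPE: expression-level identities for the exponent of (I.2.10); nothing on the Gaussian integral `E_k`; no estimate.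
-/

open scoped BigOperators InnerProductSpace
open NormedSpace

namespace Literature.MathematicalPhysics.QuantumFieldTheory.Balaban1983to89.B3Eq114AveragingVertices

open Literature.MathematicalPhysics.QuantumFieldTheory.Balaban1983to89.HiggsLattice (ChargeData)
open Literature.MathematicalPhysics.QuantumFieldTheory.Balaban1983to89.HiggsAveraging (blockK)
open Literature.MathematicalPhysics.QuantumFieldTheory.Balaban1983to89.HiggsCovariance (E)
open Literature.MathematicalPhysics.QuantumFieldTheory.Balaban1983to89.B3VertexTensorBounds
  (taylorRemOp exp_eq_taylor_sum_add')
open Literature.MathematicalPhysics.QuantumFieldTheory.Balaban1983to89.B3Eq18VertexExpansion (Op)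

noncomputable section

variable {P : HiggsLattice.Params} {N k : ℕ}

/-! ## §1. The expressions (1.12)–(1.15) -/

section Vertices

variable (C : ChargeData N)

/-- **(1.12)** p. 413: the external field `φ(y)`, `y ∈ T₁^{(k)} ∩ Ω`. [cite: Balaban1983Higgs3, (1.12) p.413] -/
def vertex112 (φ : HiggsLattice.ScalarField P k N) (y : HiggsLattice.Site P k) : E N := φ y

/-- **(1.13)** p. 413: `−(Q_k(B̃)φ′)(y) = −Σ_{x∈B^k(y)} w·U(B̃(Γ^{(k)}_{y,x}))φ′(x)` with print's weight `w = η^d`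
(`η = L^{−k}`; the tree's (I.2.11) carries `w = L^{−kd}`); `β x = B̃(Γ^{(k)}_{y,x})` (`= Σ_{b⊂Γ}ηB̃_b`, so the transport is
`U` at spacing `1`, as in `B3MultiscaleFields.holK13`). [cite: Balaban1983Higgs3, (1.13) p.413] -/
def vertex113 (w : ℝ) (β : HiggsLattice.Site P 0 → ℝ) (φ' : HiggsLattice.ScalarField P 0 N) (k : ℕ) (y : HiggsLattice.Site P k) : E N :=
  -(w • ∑ x ∈ blockK k y, C.U 1 (β x) (φ' x))

/-- **(1.14)** p. 413:
`−(e(L^kε))^{n+n′}·(1/(n!n′!))·Σ_{x∈B^k(y)} w (A′(Γ^{(k)}_{y,x}))^n(Ã(Γ^{(k)}_{y,x}))^{n′} q^{n+n′}U(B̃(Γ^{(k)}_{y,x}))φ′(x)`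
(`α x = A′(Γ)`, `τ x = Ã(Γ)`; meaningful for `n + n′ ≧ 1`). [cite: Balaban1983Higgs3, (1.14) p.413] -/
def vertex114 (w : ℝ) (β α τ : HiggsLattice.Site P 0 → ℝ) (φ' : HiggsLattice.ScalarField P 0 N) (k n n' : ℕ) (y : HiggsLattice.Site P k) : E N :=
  -((C.e ^ (n + n') * (1 / ((n.factorial : ℝ) * n'.factorial)))
      • (w • ∑ x ∈ blockK k y, (α x ^ n * τ x ^ n') • (C.q ^ (n + n')) (C.U 1 (β x) (φ' x))))

/-- **(1.15)** p. 414, the R-vertex of (1.14):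
`−(e(L^kε))^{n+n̄+1}·(1/(n!(n̄+1)!))·Σ_{x∈B^k(y)} w (A′(Γ))^n(Ã(Γ))^{n̄+1}·q^{n+n̄+1}R_{n̄+1}(qe(L^kε)Ã(Γ))U(B̃(Γ))φ′(x)`
(`R_{n̄+1}` = r15's `taylorRemOp n̄`). [cite: Balaban1983Higgs3, (1.15) p.414] -/
def vertex115 (w : ℝ) (β α τ : HiggsLattice.Site P 0 → ℝ) (φ' : HiggsLattice.ScalarField P 0 N) (k nbar n : ℕ) (y : HiggsLattice.Site P k) : E N :=
  -((C.e ^ (n + nbar + 1) * (1 / ((n.factorial : ℝ) * (nbar + 1).factorial)))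
      • (w • ∑ x ∈ blockK k y, (α x ^ n * τ x ^ (nbar + 1))
          • ((C.q ^ (n + nbar + 1) * taylorRemOp nbar ((C.e * τ x) • C.q)) (C.U 1 (β x) (φ' x)))))

/-- The averaged old field `−(Q_k(B̃ + e′A′ + Ã)φ′)(y) = −Σ_{x∈B^k(y)} w·U((B̃ + e′A′ + Ã)(Γ^{(k)}_{y,x}))φ′(x)` as a
function of `e′` (the quantity expanded on p. 413; (I.2.11)). [cite: Balaban1983Higgs3, (1.13) p.413] -/
def avgTerm (w : ℝ) (β α τ : HiggsLattice.Site P 0 → ℝ) (φ' : HiggsLattice.ScalarField P 0 N) (k : ℕ) (y : HiggsLattice.Site P k) (s : ℝ) : E N :=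
  -(w • ∑ x ∈ blockK k y, C.U 1 (β x + s * α x + τ x) (φ' x))

/-- (1.14) at `n = n′ = 0` is (1.13) (`e^0/(0!0!) = 1`, `q^0 = 1`). [cite: Balaban1983Higgs3, (1.13)–(1.14) p.413] -/
theorem vertex114_zero_zero (w : ℝ) (β α τ : HiggsLattice.Site P 0 → ℝ) (φ' : HiggsLattice.ScalarField P 0 N) (k : ℕ) (y : HiggsLattice.Site P k) :
    vertex114 C w β α τ φ' k 0 0 y = vertex113 C w β φ' k y := by
  unfold vertex114 vertex113
  simp only [add_zero, pow_zero, Nat.factorial_zero, Nat.cast_one, mul_one, div_one, one_smul]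
  rfl

end Vertices

/-! ## §2. `U((B̃ + e′A′ + Ã)(Γ)) = exp(e′Y)·exp(Z)·U(B̃(Γ))` and the `e′`-derivatives -/

section Derivatives

variable (C : ChargeData N) (w : ℝ) (β α τ : HiggsLattice.Site P 0 → ℝ) (φ' : HiggsLattice.ScalarField P 0 N) (k : ℕ) (y : HiggsLattice.Site P k)

/-- `Y_x = eA′(Γ^{(k)}_{y,x})·q`, the `e′`-generator: `U(e′A′(Γ)) = exp(e′Y_x)`. [cite: Balaban1983Higgs3, (1.14) p.413] -/
def opY (x : HiggsLattice.Site P 0) : Op N := (C.e * α x) • C.q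

/-- `Z_x = eÃ(Γ^{(k)}_{y,x})·q`: `U(Ã(Γ)) = exp(Z_x)`, the argument of `R_{n̄+1}` in (1.15). [cite: Balaban1983Higgs3, (1.15) p.414] -/
def opZ (x : HiggsLattice.Site P 0) : Op N := (C.e * τ x) • C.q

/-- `U(β + e′α + τ) = exp(e′Y)·(exp(Z)·U(β))` at spacing `1` (`U` a one-parameter group, (I.1.7)). [cite: Balaban1982Higgs1, (1.7) p.605] -/
theorem U_one_contour (x : HiggsLattice.Site P 0) (s : ℝ) :
    C.U 1 (β x + s * α x + τ x) = exp (s • opY C α x) * (exp (opZ C τ x) * C.U 1 (β x)) := by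
  rw [show β x + s * α x + τ x = s * α x + (τ x + β x) by ring, C.U_add, C.U_add]
  unfold ChargeData.U opY opZ
  congr 1
  · rw [smul_smul]
    congr 1
    congr 1
    ring
  · congr 1
    congr 1
    congr 1
    ring

/-- The `n`-th `e′`-derivative of `avgTerm` in closed form: `−Σ_x w·Y_xⁿ exp(e′Y_x) exp(Z_x) U(β_x) φ′(x)`. [cite: Balaban1983Higgs3, (1.14) p.413] -/
def avgDeriv (n : ℕ) (s : ℝ) : E N :=
  -(w • ∑ x ∈ blockK k y, (opY C α x ^ n * (exp (s • opY C α x) * (exp (opZ C τ x) * C.U 1 (β x)))) (φ' x))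

/-- `avgTerm = avgDeriv 0`. [cite: Balaban1983Higgs3, (1.13) p.413] -/
theorem avgTerm_eq_avgDeriv_zero : avgTerm C w β α τ φ' k y = avgDeriv C w β α τ φ' k y 0 := by
  funext s
  unfold avgTerm avgDeriv
  simp only [U_one_contour, pow_zero, one_mul]

/-- Mathlib's `IsScalarTower.right` for the operator algebra (form expected by instance search). [folklore] -/
private theorem clm_isScalarTower : IsScalarTower ℝ (Op N) (Op N) := IsScalarTower.right (R := ℝ) (A := Op N)

/-- Companion of `clm_isScalarTower` (Mathlib's `Algebra.to_smulCommClass`). [folklore] -/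
private theorem clm_smulCommClass : SMulCommClass ℝ (Op N) (Op N) := Algebra.to_smulCommClass (R := ℝ) (A := Op N)

/-- `d/de′ [Yⁿexp(e′Y)Tv] = Y^{n+1}exp(e′Y)Tv` (Mathlib: `d/dt exp(tY) = Y exp(tY)`). [folklore] -/
private theorem hasDerivAt_apply_pow_mul_exp (v : E N) (Y T : Op N) (n : ℕ) (s : ℝ) :
    HasDerivAt (fun s : ℝ => (Y ^ n * (exp (s • Y) * T)) v) ((Y ^ (n + 1) * (exp (s • Y) * T)) v) s := by
  haveI := clm_isScalarTower (N := N); haveI := clm_smulCommClass (N := N)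
  have h1 : HasDerivAt (fun s : ℝ => exp (s • Y)) (Y * exp (s • Y)) s := hasDerivAt_exp_smul_const' (𝕂 := ℝ) Y s
  let M : Op N →L[ℝ] Op N :=
    (ContinuousLinearMap.mul ℝ (Op N) (Y ^ n)).comp ((ContinuousLinearMap.mul ℝ (Op N)).flip T)
  have hM : ∀ S, M S = Y ^ n * (S * T) := fun S => by simp [M]
  have h2 : HasDerivAt (fun s : ℝ => M (exp (s • Y))) (M (Y * exp (s • Y))) s := M.hasFDerivAt.comp_hasDerivAt s h1
  have h3 : HasDerivAt (fun s : ℝ => (ContinuousLinearMap.apply ℝ (E N) v) (M (exp (s • Y))))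
      ((ContinuousLinearMap.apply ℝ (E N) v) (M (Y * exp (s • Y)))) s :=
    (ContinuousLinearMap.apply ℝ (E N) v).hasFDerivAt.comp_hasDerivAt s h2
  have h4 : ∀ S, (ContinuousLinearMap.apply ℝ (E N) v) (M S) = (Y ^ n * (S * T)) v := fun S => by
    rw [ContinuousLinearMap.apply_apply, hM]
  simp only [h4] at h3
  convert h3 using 2
  rw [pow_succ, mul_assoc, mul_assoc]

/-- `d/de′ avgDeriv n = avgDeriv (n+1)`. [cite: Balaban1983Higgs3, (1.14) p.413] -/
theorem hasDerivAt_avgDeriv (n : ℕ) (s : ℝ) :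
    HasDerivAt (avgDeriv C w β α τ φ' k y n) (avgDeriv C w β α τ φ' k y (n + 1) s) s := by
  have hx : ∀ x ∈ blockK k y, HasDerivAt
      (fun s : ℝ => (opY C α x ^ n * (exp (s • opY C α x) * (exp (opZ C τ x) * C.U 1 (β x)))) (φ' x))
      ((opY C α x ^ (n + 1) * (exp (s • opY C α x) * (exp (opZ C τ x) * C.U 1 (β x)))) (φ' x)) s :=
    fun x _ => hasDerivAt_apply_pow_mul_exp (φ' x) (opY C α x) (exp (opZ C τ x) * C.U 1 (β x)) n s
  have h1 := HasDerivAt.fun_sum hx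
  have h2 : HasDerivAt
      (fun s : ℝ => -(w • ∑ x ∈ blockK k y,
        (opY C α x ^ n * (exp (s • opY C α x) * (exp (opZ C τ x) * C.U 1 (β x)))) (φ' x)))
      (-(w • ∑ x ∈ blockK k y,
        (opY C α x ^ (n + 1) * (exp (s • opY C α x) * (exp (opZ C τ x) * C.U 1 (β x)))) (φ' x))) s :=
    (h1.const_smul w).neg
  exact h2

/-- From a derivative chain to all iterated derivatives (vector-valued). [folklore] -/
private theorem iteratedDeriv_eq_of_hasDerivAt_succ {F : Type*} [NormedAddCommGroup F] [NormedSpace ℝ F]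
    (f : ℕ → ℝ → F) (hf : ∀ n s, HasDerivAt (f n) (f (n + 1) s) s) (n : ℕ) : iteratedDeriv n (f 0) = f n := by
  induction n with
  | zero => exact iteratedDeriv_zero
  | succ n ih =>
      rw [iteratedDeriv_succ, ih]
      funext s
      exact (hf n s).deriv

/-- **All `e′`-derivatives of `−(Q_k(B̃+e′A′+Ã)φ′)(y)` in closed form.** [cite: Balaban1983Higgs3, (1.14) p.413] -/
theorem iteratedDeriv_avgTerm (n : ℕ) :
    iteratedDeriv n (avgTerm C w β α τ φ' k y) = avgDeriv C w β α τ φ' k y n := by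
  rw [avgTerm_eq_avgDeriv_zero]
  exact iteratedDeriv_eq_of_hasDerivAt_succ _ (hasDerivAt_avgDeriv C w β α τ φ' k y) n

/-- The averaged term is smooth in `e′`. [cite: Balaban1983Higgs3, (1.5) p.412] -/
theorem contDiff_avgTerm {m : ℕ∞} : ContDiff ℝ m (avgTerm C w β α τ φ' k y) := by
  rw [avgTerm_eq_avgDeriv_zero]
  refine contDiff_of_differentiable_iteratedDeriv fun n _ => ?_
  rw [iteratedDeriv_eq_of_hasDerivAt_succ _ (hasDerivAt_avgDeriv C w β α τ φ' k y) n]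
  exact fun s => (hasDerivAt_avgDeriv C w β α τ φ' k y n s).differentiableAt

/-- (I.3.14) multiplied out: `(yq)ⁿ·exp(zq) = Σ_{m≦n̄}(m!)^{−1}yⁿz^m q^{n+m} + ((n̄+1)!)^{−1}yⁿz^{n̄+1} q^{n+n̄+1}R_{n̄+1}(zq)`.
[cite: Balaban1982Higgs1, (3.14) p.614] -/
theorem smul_q_pow_mul_exp (nbar n : ℕ) (a z : ℝ) :
    (a • C.q) ^ n * exp (z • C.q)
      = ∑ m ∈ Finset.range (nbar + 1), (((m.factorial : ℝ)⁻¹) * (a ^ n * z ^ m)) • C.q ^ (n + m)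
        + ((((nbar + 1).factorial : ℝ)⁻¹) * (a ^ n * z ^ (nbar + 1)))
            • (C.q ^ (n + nbar + 1) * taylorRemOp nbar (z • C.q)) := by
  haveI := clm_isScalarTower (N := N); haveI := clm_smulCommClass (N := N)
  rw [exp_eq_taylor_sum_add' nbar (z • C.q), mul_add, Finset.mul_sum]
  congr 1
  · refine Finset.sum_congr rfl fun m _ => ?_
    rw [mul_smul_comm, smul_pow, smul_pow, smul_mul_smul_comm, ← pow_add, smul_smul]
  · rw [mul_smul_comm, smul_pow, smul_pow, ← mul_assoc, smul_mul_smul_comm, ← pow_add, smul_mul_assoc, smul_smul,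
      show n + (nbar + 1) = n + nbar + 1 from (add_assoc n nbar 1).symm]

/-- The same applied to a vector `u`: `Yⁿexp(Z)u` as the finite sum of the (1.14)/(1.15) tensors on `u`. [cite: Balaban1982Higgs1, (3.14) p.614] -/
theorem apply_opY_pow_mul_exp_opZ (nbar n : ℕ) (x : HiggsLattice.Site P 0) (u : E N) :
    (opY C α x ^ n * exp (opZ C τ x)) u
      = ∑ m ∈ Finset.range (nbar + 1),
          (((m.factorial : ℝ)⁻¹) * ((C.e * α x) ^ n * (C.e * τ x) ^ m)) • (C.q ^ (n + m)) u
        + ((((nbar + 1).factorial : ℝ)⁻¹) * ((C.e * α x) ^ n * (C.e * τ x) ^ (nbar + 1)))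
            • (C.q ^ (n + nbar + 1) * taylorRemOp nbar ((C.e * τ x) • C.q)) u := by
  have key : ∀ T : Op N, T u = (ContinuousLinearMap.apply ℝ (E N) u) T := fun T => rfl
  unfold opY opZ
  rw [key, smul_q_pow_mul_exp C nbar n (C.e * α x) (C.e * τ x), map_add, map_sum]
  simp only [map_smul, key]

end Derivatives

/-! ## §3. *"connected with the expansion of the renormalization transformation for scalar fields"* -/

section Expansion

variable (C : ChargeData N) (w : ℝ) (β α τ : HiggsLattice.Site P 0 → ℝ) (φ' : HiggsLattice.ScalarField P 0 N) (k : ℕ) (y : HiggsLattice.Site P k)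

/-- Finite-sum bookkeeping (vector-valued): split off the `n + m = 0` term. [folklore] -/
private theorem sum_range_split_pos {F : Type*} [AddCommGroup F] (f : ℕ → F) (n nbar : ℕ) :
    ∑ m ∈ Finset.range (nbar + 1), f m
      = (if n = 0 then f 0 else 0) + ∑ m ∈ (Finset.range (nbar + 1)).filter (fun m => 1 ≤ n + m), f m := by
  rw [Finset.sum_filter]
  rcases Nat.eq_zero_or_pos n with h | h
  · subst h
    rw [if_pos rfl, Finset.sum_range_succ' (fun m => if 1 ≤ 0 + m then f m else 0), Finset.sum_range_succ' f]
    have h0 : (if 1 ≤ 0 + 0 then f 0 else 0) = 0 := if_neg (by omega)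
    have h1 : ∀ m : ℕ, (if 1 ≤ 0 + (m + 1) then f (m + 1) else 0) = f (m + 1) := fun m => if_pos (by omega)
    simp only [h0, h1, add_zero]
    exact add_comm _ _
  · rw [if_neg (by omega), zero_add]
    exact Finset.sum_congr rfl fun m _ => (if_pos (by omega)).symm

/-- Pulling the scalars of `(1/n!)·(−(w·Σ_x c_x v_x))` inside. [folklore] -/
private theorem smul_neg_smul_sum (a b : ℝ) (s : Finset (HiggsLattice.Site P 0)) (c : HiggsLattice.Site P 0 → ℝ) (v : HiggsLattice.Site P 0 → E N) :
    a • -(b • ∑ x ∈ s, c x • v x) = ∑ x ∈ s, (-(a * b * c x)) • v x := by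
  rw [smul_neg, smul_smul, Finset.smul_sum, ← Finset.sum_neg_distrib]
  refine Finset.sum_congr rfl fun x _ => ?_
  rw [smul_smul, ← neg_smul, mul_assoc]

/-- Pulling the scalars of `−(a·(w·Σ_x c_x v_x))` inside. [folklore] -/
private theorem neg_smul_smul_sum (a b : ℝ) (s : Finset (HiggsLattice.Site P 0)) (c : HiggsLattice.Site P 0 → ℝ)
    (v : HiggsLattice.Site P 0 → E N) :
    -(a • (b • ∑ x ∈ s, c x • v x)) = ∑ x ∈ s, (-(a * b * c x)) • v x := by
  rw [smul_smul, Finset.smul_sum, ← Finset.sum_neg_distrib]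
  refine Finset.sum_congr rfl fun x _ => ?_
  rw [smul_smul, ← neg_smul, mul_assoc]

/-- **p. 413: (1.13)–(1.15) *"are connected with the expansion of the renormalization transformation for scalar fields"*.**
For every order `n` of `∂/∂e′`, every truncation order `n̄` of (I.3.14) in `Ã`, every block point `y` and all fields:
`(1/n!)·∂ⁿ_{e′}|_{e′=0}(−(Q_k(B̃ + e′A′ + Ã)φ′)(y)) = [n=0]·(1.13) + Σ_{n′≦n̄, n+n′≧1}(1.14)_{n,n′} + (1.15)_n`.
[cite: Balaban1983Higgs3, (1.13)–(1.15) pp.413–414] -/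
theorem taylorCoeff_avgTerm (nbar n : ℕ) :
    ((n.factorial : ℝ)⁻¹) • iteratedDeriv n (avgTerm C w β α τ φ' k y) 0
      = (if n = 0 then vertex113 C w β φ' k y else 0)
        + (∑ n' ∈ (Finset.range (nbar + 1)).filter (fun n' => 1 ≤ n + n'), vertex114 C w β α τ φ' k n n' y)
        + vertex115 C w β α τ φ' k nbar n y := by
  -- (i) closed form at `e′ = 0`, expanded by (I.3.14)
  have h0 : ∀ x : HiggsLattice.Site P 0, (0 : ℝ) • opY C α x = 0 := fun x => zero_smul ℝ (opY C α x)
  have hD : ((n.factorial : ℝ)⁻¹) • iteratedDeriv n (avgTerm C w β α τ φ' k y) 0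
      = (∑ m ∈ Finset.range (nbar + 1), vertex114 C w β α τ φ' k n m y) + vertex115 C w β α τ φ' k nbar n y := by
    rw [iteratedDeriv_avgTerm]
    unfold avgDeriv
    simp only [h0, exp_zero, one_mul]
    have happ : ∀ x : HiggsLattice.Site P 0,
        (opY C α x ^ n * (exp (opZ C τ x) * C.U 1 (β x))) (φ' x)
          = (opY C α x ^ n * exp (opZ C τ x)) (C.U 1 (β x) (φ' x)) := fun x => by
      rw [← mul_assoc]; rfl
    simp only [happ, apply_opY_pow_mul_exp_opZ C α τ nbar n]
    rw [Finset.sum_add_distrib, smul_add, neg_add, smul_add]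
    congr 1
    · rw [Finset.sum_comm, Finset.smul_sum, ← Finset.sum_neg_distrib, Finset.smul_sum]
      refine Finset.sum_congr rfl fun m _ => ?_
      unfold vertex114
      rw [smul_neg_smul_sum, neg_smul_smul_sum]
      refine Finset.sum_congr rfl fun x _ => ?_
      congr 1
      field_simp
      ring
    · unfold vertex115
      rw [smul_neg_smul_sum, neg_smul_smul_sum]
      refine Finset.sum_congr rfl fun x _ => ?_
      congr 1
      field_simp
      ring
  rw [hD, sum_range_split_pos (fun m => vertex114 C w β α τ φ' k n m y) n nbar]
  congr 2
  split_ifs with h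
  · subst h
    exact vertex114_zero_zero C w β α τ φ' k y
  · rfl

/-- At `Ã = 0` the expressions (1.14) with `n′ ≧ 1` vanish. [cite: Balaban1983Higgs3, p.414 (after (1.15))] -/
theorem vertex114_noSmallField {n' : ℕ} (hn' : 1 ≤ n') (n : ℕ) :
    vertex114 C w β α (fun _ => 0) φ' k n n' y = 0 := by
  unfold vertex114
  have hz : (0 : ℝ) ^ n' = 0 := zero_pow (by omega)
  simp only [hz, mul_zero, zero_smul, Finset.sum_const_zero, smul_zero, neg_zero]

/-- At `Ã = 0` the R-vertex (1.15) vanishes. [cite: Balaban1983Higgs3, p.414 (after (1.15))] -/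
theorem vertex115_noSmallField (nbar n : ℕ) : vertex115 C w β α (fun _ => 0) φ' k nbar n y = 0 := by
  unfold vertex115
  have hz : (0 : ℝ) ^ (nbar + 1) = 0 := zero_pow (Nat.succ_ne_zero nbar)
  simp only [hz, mul_zero, zero_smul, Finset.sum_const_zero, smul_zero, neg_zero]

/-- **p. 414: *"… (1.13), and (1.14) with n′ = 0"*** — with no small field the `e′`-expansion of `−(Q_k(B̃+e′A′)φ′)(y)` is
exact: `(1/n!)·∂ⁿ_{e′}|₀ = (1.14)_{n,0}` for `n ≧ 1` (and (1.13) for `n = 0`). [cite: Balaban1983Higgs3, p.414 (after (1.15))] -/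
theorem taylorCoeff_avgTerm_noSmallField {n : ℕ} (hn : 1 ≤ n) :
    ((n.factorial : ℝ)⁻¹) • iteratedDeriv n (avgTerm C w β α (fun _ => 0) φ' k y) 0
      = vertex114 C w β α (fun _ => 0) φ' k n 0 y := by
  rw [taylorCoeff_avgTerm C w β α (fun _ => 0) φ' k y 0 n, if_neg (by omega), vertex115_noSmallField, zero_add,
    add_zero]
  have hf1 : (Finset.range (0 + 1)).filter (fun n' => 1 ≤ n + n') = {0} := by
    ext m
    simp only [Finset.mem_filter, Finset.mem_range, Finset.mem_singleton]
    omega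
  rw [hf1, Finset.sum_singleton]

end Expansion

/-! ## §4. The pairing rule p. 414 -/

section Pairing

/-- Double sums over a finite set split along a linear order: `Σ_iΣ_j g = Σ_i g(i,i) + Σ_iΣ_{j>i} g + Σ_iΣ_{j<i} g`. [folklore] -/
private theorem sum_sum_split {ι : Type*} [LinearOrder ι] (s : Finset ι) (g : ι → ι → ℝ) :
    ∑ i ∈ s, ∑ j ∈ s, g i j
      = (∑ i ∈ s, g i i) + (∑ i ∈ s, ∑ j ∈ s.filter (fun j => i < j), g i j)
        + ∑ i ∈ s, ∑ j ∈ s.filter (fun j => j < i), g i j := by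
  rw [← Finset.sum_add_distrib, ← Finset.sum_add_distrib]
  refine Finset.sum_congr rfl fun i hi => ?_
  have h1 := Finset.sum_filter_add_sum_filter_not s (fun j => i < j) (g i)
  have h2 := Finset.sum_filter_add_sum_filter_not (s.filter fun j => ¬i < j) (fun j => j < i) (g i)
  rw [Finset.filter_filter, Finset.filter_filter] at h2
  have hA : s.filter (fun j => ¬i < j ∧ j < i) = s.filter (fun j => j < i) :=
    Finset.filter_congr fun j _ => ⟨fun h => h.2, fun h => ⟨not_lt.mpr h.le, h⟩⟩
  have hB : s.filter (fun j => ¬i < j ∧ ¬j < i) = {i} := by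
    ext j
    simp only [Finset.mem_filter, Finset.mem_singleton, not_lt]
    constructor
    · rintro ⟨-, hji, hij⟩
      exact le_antisymm hji hij
    · intro h
      subst h
      exact ⟨hi, le_rfl, le_rfl⟩
  rw [hA, hB, Finset.sum_singleton] at h2
  rw [← h1, ← h2]
  ring

/-- The lower triangle is the upper triangle of the transposed summand. [folklore] -/
private theorem sum_sum_lower_eq_upper {ι : Type*} [LinearOrder ι] (s : Finset ι) (g : ι → ι → ℝ) :
    ∑ i ∈ s, ∑ j ∈ s.filter (fun j => j < i), g i j = ∑ i ∈ s, ∑ j ∈ s.filter (fun j => i < j), g j i := by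
  refine Finset.sum_comm' fun i j => ?_
  simp only [Finset.mem_filter]
  tauto

/-- **The pairing rule of p. 414** (*"we take an arbitrary pair of two expressions … and we take their scalar product. We
multiply it by −a_k if the expressions are different, or by −½a_k if they are equal"*): for every finite, linearly
ordered family of vectors `T_i` of `ℝ^N` and every `a`,
`−½a‖Σ_i T_i‖² = Σ_i (−½a)‖T_i‖² + Σ_{i<j} (−a)⟨T_i, T_j⟩`. [cite: Balaban1983Higgs3, p.414 (after (1.15))] -/
theorem pairing_rule {ι : Type*} [LinearOrder ι] (s : Finset ι) (T : ι → E N) (a : ℝ) :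
    -(1 / 2 : ℝ) * a * ‖∑ i ∈ s, T i‖ ^ 2
      = (∑ i ∈ s, -(1 / 2 : ℝ) * a * ‖T i‖ ^ 2)
        + ∑ i ∈ s, ∑ j ∈ s.filter (fun j => i < j), -a * ⟪T i, T j⟫_ℝ := by
  have hsq : ‖∑ i ∈ s, T i‖ ^ 2 = ∑ i ∈ s, ∑ j ∈ s, ⟪T i, T j⟫_ℝ := by
    rw [← real_inner_self_eq_norm_sq, sum_inner]
    exact Finset.sum_congr rfl fun i _ => inner_sum _ _ _
  rw [hsq, sum_sum_split, sum_sum_lower_eq_upper]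
  have hsym : ∑ i ∈ s, ∑ j ∈ s.filter (fun j => i < j), ⟪T j, T i⟫_ℝ
      = ∑ i ∈ s, ∑ j ∈ s.filter (fun j => i < j), ⟪T i, T j⟫_ℝ :=
    Finset.sum_congr rfl fun i _ => Finset.sum_congr rfl fun j _ => real_inner_comm _ _
  have e1 : ∑ i ∈ s, -(1 / 2 : ℝ) * a * ‖T i‖ ^ 2 = -(1 / 2 : ℝ) * a * ∑ i ∈ s, ‖T i‖ ^ 2 := by
    rw [Finset.mul_sum]
  have e2 : ∑ i ∈ s, ∑ j ∈ s.filter (fun j => i < j), -a * ⟪T i, T j⟫_ℝ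
      = -a * ∑ i ∈ s, ∑ j ∈ s.filter (fun j => i < j), ⟪T i, T j⟫_ℝ := by
    rw [Finset.mul_sum]
    exact Finset.sum_congr rfl fun i _ => by rw [Finset.mul_sum]
  have e3 : ∑ i ∈ s, ⟪T i, T i⟫_ℝ = ∑ i ∈ s, ‖T i‖ ^ 2 :=
    Finset.sum_congr rfl fun i _ => real_inner_self_eq_norm_sq _
  rw [hsym, e1, e2, e3]
  ring

/-- The pairs inside {(1.12), (1.13)} — excluded from the vertices by print's *"at least one of them has to be of the form
(1.14) or (1.15)"* — reassemble the unperturbed Gaussian term of the renormalization transformation: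
`−½a‖φ(y)‖² − a⟨φ(y), −(Q_k(B̃)φ′)(y)⟩ − ½a‖(Q_k(B̃)φ′)(y)‖² = −½a‖φ(y) − (Q_k(B̃)φ′)(y)‖²`. [cite: Balaban1983Higgs3, p.414 (after (1.15))] -/
theorem pairing_base (a : ℝ) (v12 v13 : E N) :
    -(1 / 2 : ℝ) * a * ‖v12‖ ^ 2 + -a * ⟪v12, v13⟫_ℝ + -(1 / 2 : ℝ) * a * ‖v13‖ ^ 2
      = -(1 / 2 : ℝ) * a * ‖v12 + v13‖ ^ 2 := by
  rw [norm_add_sq_real]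
  ring

/-- The sum of ALL the expressions is `φ(y) − (Q_k(B̃+e′A′+Ã)φ′)(y)` before expansion: (1.12) + `avgTerm`; the pairing
rule applied to any finite family summing to it gives `−½a‖φ(y) − (Q_kφ′)(y)‖²`, the exponent of the kernel (I.2.10) of
`T^η_{a_k,L^k,·}` in (1.4). [cite: Balaban1983Higgs3, p.414 (after (1.15))] [cite: Balaban1982Higgs1, (2.10) p.609] -/
theorem pairing_total {ι : Type*} [LinearOrder ι] (s : Finset ι) (T : ι → E N) (a : ℝ) (φ : HiggsLattice.ScalarField P k N)
    (C : ChargeData N) (w : ℝ) (β α τ : HiggsLattice.Site P 0 → ℝ) (φ' : HiggsLattice.ScalarField P 0 N) (y : HiggsLattice.Site P k) (e' : ℝ)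
    (hT : ∑ i ∈ s, T i = vertex112 φ y + avgTerm C w β α τ φ' k y e') :
    (∑ i ∈ s, -(1 / 2 : ℝ) * a * ‖T i‖ ^ 2) + ∑ i ∈ s, ∑ j ∈ s.filter (fun j => i < j), -a * ⟪T i, T j⟫_ℝ
      = -(1 / 2 : ℝ) * a * ‖φ y - w • ∑ x ∈ blockK k y, C.U 1 (β x + e' * α x + τ x) (φ' x)‖ ^ 2 := by
  rw [← pairing_rule, hT]
  unfold vertex112 avgTerm
  rw [sub_eq_add_neg]

end Pairing

/-! ## §5. The typed (1.4): `Q_k(e′g_k𝒜 + A^{(k)})` of `B3Eq14AuxFunction.Data14` -/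

section Data14

open Literature.MathematicalPhysics.QuantumFieldTheory.Balaban1983to89.B3MultiscaleFields (etaSumK etaSumK_add holK13)
open Literature.MathematicalPhysics.QuantumFieldTheory.Balaban1983to89.B3Eq14AuxFunction
open Literature.MathematicalPhysics.QuantumFieldTheory.Balaban1983to89.B3Eq15ChargeDerivative

variable {K : ℕ} (D : Data14 P N K)

/-- **`−(Q_k(e′g_k𝒜 + Ã + B̃)φ′)(y)` of the typed (1.4) IS `avgTerm`** with the tree's weight `w = L^{−kd}` ((I.2.11)), the
contour functionals `β = B̃(Γ^{(k)}_{y,x})`, `τ = Ã(Γ^{(k)}_{y,x})` (`etaSumK`) and the (1.3)-functional `α = a_x(A′)` of the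
fluctuation family (`Data14.fluctContour`). [cite: Balaban1983Higgs3, (1.3)–(1.4) p.412, (1.13) p.413] -/
theorem neg_avgQ14_eq_avgTerm (At Bt : HiggsLattice.VecField P 0) (A' : (j : Fin K) → HiggsLattice.VecField P j) (φ' : HiggsLattice.ScalarField P 0 N)
    (y : HiggsLattice.Site P K) (s : ℝ) :
    -(D.avgQ14 (At + Bt) s A' φ' y)
      = avgTerm D.C (((P.L : ℝ) ^ (K * P.d))⁻¹) (fun x => etaSumK Bt K x) (fluctContour D A')
          (fun x => etaSumK At K x) φ' K y s := by
  rw [Data14.avgQ14_apply]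
  unfold avgTerm
  congr 2
  refine Finset.sum_congr rfl fun x _ => ?_
  rw [holK13, contour13_extPieces D, etaSumK_add,
    show etaSumK At K x + etaSumK Bt K x + s * fluctContour D A' x
      = etaSumK Bt K x + s * fluctContour D A' x + etaSumK At K x by ring]

/-- **(1.13)–(1.15) for the typed (1.4)**: the `e′`-Taylor coefficients of `−(Q_k(e′g_k𝒜 + Ã + B̃)φ′)(y)` are
`[n=0]·(1.13) + Σ_{n′≦n̄, n+n′≧1}(1.14)_{n,n′} + (1.15)_n` with `w = L^{−kd}` and the functionals of `neg_avgQ14_eq_avgTerm`,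
for every `n`, `n̄`, `y`. [cite: Balaban1983Higgs3, (1.13)–(1.15) pp.413–414] -/
theorem taylorCoeff_avgQ14 (At Bt : HiggsLattice.VecField P 0) (A' : (j : Fin K) → HiggsLattice.VecField P j) (φ' : HiggsLattice.ScalarField P 0 N)
    (y : HiggsLattice.Site P K) (nbar n : ℕ) :
    ((n.factorial : ℝ)⁻¹) • iteratedDeriv n (fun e' : ℝ => -(D.avgQ14 (At + Bt) e' A' φ' y)) 0
      = (if n = 0 then vertex113 D.C (((P.L : ℝ) ^ (K * P.d))⁻¹) (fun x => etaSumK Bt K x) φ' K y else 0)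
        + (∑ n' ∈ (Finset.range (nbar + 1)).filter (fun n' => 1 ≤ n + n'),
            vertex114 D.C (((P.L : ℝ) ^ (K * P.d))⁻¹) (fun x => etaSumK Bt K x) (fluctContour D A')
              (fun x => etaSumK At K x) φ' K n n' y)
        + vertex115 D.C (((P.L : ℝ) ^ (K * P.d))⁻¹) (fun x => etaSumK Bt K x) (fluctContour D A')
            (fun x => etaSumK At K x) φ' K nbar n y := by
  have hfun : (fun e' : ℝ => -(D.avgQ14 (At + Bt) e' A' φ' y))
      = avgTerm D.C (((P.L : ℝ) ^ (K * P.d))⁻¹) (fun x => etaSumK Bt K x) (fluctContour D A')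
          (fun x => etaSumK At K x) φ' K y := by
    funext s; exact neg_avgQ14_eq_avgTerm D At Bt A' φ' y s
  rw [hfun]
  exact taylorCoeff_avgTerm _ _ _ _ _ _ _ _ nbar n

/-- **p. 414: *"the vertices of (1.5) are given by … (1.13), and (1.14) with n′ = 0 and B̃ = A^{(k)}"*** for the typed
(1.4): with `A^{(k)} = B̃` (no small field) the `e′`-Taylor coefficients of `−(Q_k(e′g_k𝒜 + A^{(k)})φ′)(y)` are
`(1.14)_{n,0}` (`n ≧ 1`; weight `L^{−kd}`, `β = A^{(k)}(Γ^{(k)}_{y,x})`, `α = a_x(A′)`). [cite: Balaban1983Higgs3, p.414 (after (1.15))] -/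
theorem taylorCoeff_avgQ14_noSmallField (Ak : HiggsLattice.VecField P 0) (A' : (j : Fin K) → HiggsLattice.VecField P j)
    (φ' : HiggsLattice.ScalarField P 0 N) (y : HiggsLattice.Site P K) {n : ℕ} (hn : 1 ≤ n) :
    ((n.factorial : ℝ)⁻¹) • iteratedDeriv n (fun e' : ℝ => -(D.avgQ14 Ak e' A' φ' y)) 0
      = vertex114 D.C (((P.L : ℝ) ^ (K * P.d))⁻¹) (fun x => etaSumK Ak K x) (fluctContour D A')
          (fun _ => 0) φ' K n 0 y := by
  have hfun : (fun e' : ℝ => -(D.avgQ14 Ak e' A' φ' y))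
      = avgTerm D.C (((P.L : ℝ) ^ (K * P.d))⁻¹) (fun x => etaSumK Ak K x) (fluctContour D A')
          (fun _ => 0) φ' K y := by
    funext s
    rw [Data14.avgQ14_apply]
    unfold avgTerm
    congr 2
    refine Finset.sum_congr rfl fun x _ => ?_
    rw [holK13, contour13_extPieces D, add_zero]
  rw [hfun]
  exact taylorCoeff_avgTerm_noSmallField _ _ _ _ _ _ _ hn

end Data14

/-! ## §6. The pairing rule at the level of the `e′`-Taylor coefficients (Leibniz) — v1.1 -/

section PairingTaylor

variable (C : ChargeData N) (w : ℝ) (β α τ : HiggsLattice.Site P 0 → ℝ) (φ' : HiggsLattice.ScalarField P 0 N) (k : ℕ)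
  (y : HiggsLattice.Site P k)

/-- Leibniz sums `Σ_{i+j=n} C(n,i)⟨F_i(s), F_j(s)⟩` of a derivative chain `F`. [folklore] -/
private def leib (F : ℕ → ℝ → E N) (n : ℕ) (s : ℝ) : ℝ :=
  ∑ ij ∈ Finset.HasAntidiagonal.antidiagonal n, ((n.choose ij.1 : ℕ) : ℝ) * ⟪F ij.1 s, F ij.2 s⟫_ℝ

/-- Leibniz: `d/ds Σ_{i+j=n} C(n,i)⟨F_i, F_j⟩ = Σ_{i+j=n+1} C(n+1,i)⟨F_i, F_j⟩` (Pascal, Mathlib's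
`Finset.sum_antidiagonal_choose_succ_mul`). [folklore] -/
private theorem hasDerivAt_leib (F : ℕ → ℝ → E N) (hF : ∀ m s, HasDerivAt (F m) (F (m + 1) s) s) (n : ℕ) (s : ℝ) :
    HasDerivAt (leib F n) (leib F (n + 1) s) s := by
  have hterm : ∀ ij ∈ Finset.HasAntidiagonal.antidiagonal n, HasDerivAt (fun s => ((n.choose ij.1 : ℕ) : ℝ) * ⟪F ij.1 s, F ij.2 s⟫_ℝ)
      (((n.choose ij.1 : ℕ) : ℝ) * (⟪F ij.1 s, F (ij.2 + 1) s⟫_ℝ + ⟪F (ij.1 + 1) s, F ij.2 s⟫_ℝ)) s :=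
    fun ij _ => ((hF ij.1 s).inner ℝ (hF ij.2 s)).const_mul _
  have hsum := HasDerivAt.fun_sum hterm
  have hval : ∑ ij ∈ Finset.HasAntidiagonal.antidiagonal n,
        ((n.choose ij.1 : ℕ) : ℝ) * (⟪F ij.1 s, F (ij.2 + 1) s⟫_ℝ + ⟪F (ij.1 + 1) s, F ij.2 s⟫_ℝ)
      = leib F (n + 1) s := by
    unfold leib
    rw [Finset.sum_antidiagonal_choose_succ_mul (fun i j => ⟪F i s, F j s⟫_ℝ) n, ← Finset.sum_add_distrib]
    refine Finset.sum_congr rfl fun ij hij => ?_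
    rw [Finset.HasAntidiagonal.mem_antidiagonal] at hij
    rw [← Nat.choose_symm_of_eq_add hij.symm]
    ring
  rw [← hval]
  exact hsum

/-- `leib F 0 = ⟨F_0, F_0⟩`. [folklore] -/
private theorem leib_zero (F : ℕ → ℝ → E N) : leib F 0 = fun s => ⟪F 0 s, F 0 s⟫_ℝ := by
  funext s
  unfold leib
  rw [Finset.Nat.antidiagonal_zero, Finset.sum_singleton]
  simp

/-- The derivative chain of the TOTAL expression `φ(y) − (Q_k(B̃+e′A′+Ã)φ′)(y)` = (1.12) + `avgTerm`:
`F_0 = φ(y) + avgTerm`, `F_m = avgDeriv m` (`m ≧ 1`). [cite: Balaban1983Higgs3, (1.12)–(1.15) pp.413–414] -/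
def totalDeriv (φ : HiggsLattice.ScalarField P k N) (m : ℕ) (s : ℝ) : E N :=
  (if m = 0 then vertex112 φ y else 0) + avgDeriv C w β α τ φ' k y m s

/-- `d/de′ totalDeriv m = totalDeriv (m+1)`. [cite: Balaban1983Higgs3, (1.12)–(1.15) pp.413–414] -/
theorem hasDerivAt_totalDeriv (φ : HiggsLattice.ScalarField P k N) (m : ℕ) (s : ℝ) :
    HasDerivAt (totalDeriv C w β α τ φ' k y φ m) (totalDeriv C w β α τ φ' k y φ (m + 1) s) s := by
  have h := (hasDerivAt_const s (if m = 0 then vertex112 φ y else 0)).add (hasDerivAt_avgDeriv C w β α τ φ' k y m s)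
  have hz : totalDeriv C w β α τ φ' k y φ (m + 1) s = 0 + avgDeriv C w β α τ φ' k y (m + 1) s := by
    unfold totalDeriv
    rw [if_neg (Nat.succ_ne_zero m)]
  rw [hz]
  exact h

/-- The `e′`-Taylor coefficient of order `m` of the total expression: `E_m = [m=0]·φ(y) + (1/m!)∂^m_{e′}|₀ avgTerm`, i.e.
(by `taylorCoeff_avgTerm`) `[m=0]·((1.12) + (1.13)) + Σ_{n′≦n̄, m+n′≧1}(1.14)_{m,n′} + (1.15)_m`. [cite: Balaban1983Higgs3, (1.12)–(1.15) pp.413–414] -/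
def coeffExpr (φ : HiggsLattice.ScalarField P k N) (nbar m : ℕ) : E N :=
  (if m = 0 then vertex112 φ y + vertex113 C w β φ' k y else 0)
    + (∑ n' ∈ (Finset.range (nbar + 1)).filter (fun n' => 1 ≤ m + n'), vertex114 C w β α τ φ' k m n' y)
    + vertex115 C w β α τ φ' k nbar m y

/-- `E_m = (1/m!)·totalDeriv m (0)`. [cite: Balaban1983Higgs3, (1.12)–(1.15) pp.413–414] -/
theorem coeffExpr_eq (φ : HiggsLattice.ScalarField P k N) (nbar m : ℕ) :
    coeffExpr C w β α τ φ' k y φ nbar m = ((m.factorial : ℝ)⁻¹) • totalDeriv C w β α τ φ' k y φ m 0 := by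
  unfold coeffExpr totalDeriv
  rw [smul_add, ← iteratedDeriv_avgTerm, taylorCoeff_avgTerm C w β α τ φ' k y nbar m]
  split_ifs with h
  · subst h
    simp only [Nat.factorial_zero, Nat.cast_one, inv_one, one_smul]
    abel
  · rw [smul_zero, zero_add, zero_add]

/-- **The pairing rule p. 414 at the level of the `e′`-Taylor coefficients.**  The exponent
`−½a_k|φ(y) − (Q_k(B̃ + e′A′ + Ã)φ′)(y)|²` of the kernel (I.2.10) of `T^η_{a_k,L^k,·}` in (1.4) has, for every order `n`,
`(1/n!)·∂ⁿ_{e′}|₀(−½a|φ(y) − (Q_k(B̃+e′A′+Ã)φ′)(y)|²) = −½a Σ_{i+j=n} ⟨E_i, E_j⟩`, `E_m` = `coeffExpr` — the scalar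
products of pairs of the expressions (1.12)–(1.15) whose `A′`-orders add up to `n` (each unordered pair of distinct
expressions twice = print's factor `−a_k`, each square once = `−½a_k`), for every `n̄`. [cite: Balaban1983Higgs3, p.414 (after (1.15))] -/
theorem pairing_taylorCoeff (φ : HiggsLattice.ScalarField P k N) (a : ℝ) (nbar n : ℕ) :
    ((n.factorial : ℝ)⁻¹)
        * iteratedDeriv n (fun s : ℝ => -(1 / 2 : ℝ) * a * ‖vertex112 φ y + avgTerm C w β α τ φ' k y s‖ ^ 2) 0
      = -(1 / 2 : ℝ) * a * ∑ ij ∈ Finset.HasAntidiagonal.antidiagonal n,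
          ⟪coeffExpr C w β α τ φ' k y φ nbar ij.1, coeffExpr C w β α τ φ' k y φ nbar ij.2⟫_ℝ := by
  set F : ℕ → ℝ → E N := totalDeriv C w β α τ φ' k y φ with hF
  have hchain : ∀ m s, HasDerivAt (F m) (F (m + 1) s) s := fun m s => hasDerivAt_totalDeriv C w β α τ φ' k y φ m s
  have hG : ∀ m s, HasDerivAt (fun s => -(1 / 2 : ℝ) * a * leib F m s) (-(1 / 2 : ℝ) * a * leib F (m + 1) s) s :=
    fun m s => (hasDerivAt_leib F hchain m s).const_mul _
  have hit := iteratedDeriv_eq_of_hasDerivAt_succ (fun m s => -(1 / 2 : ℝ) * a * leib F m s) hG n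
  have hfun : (fun s : ℝ => -(1 / 2 : ℝ) * a * ‖vertex112 φ y + avgTerm C w β α τ φ' k y s‖ ^ 2)
      = fun s => -(1 / 2 : ℝ) * a * leib F 0 s := by
    funext s
    rw [leib_zero]
    beta_reduce
    rw [real_inner_self_eq_norm_sq, hF]
    unfold totalDeriv
    rw [if_pos rfl, ← avgTerm_eq_avgDeriv_zero]
  rw [hfun, hit]
  beta_reduce
  unfold leib
  simp only [Finset.mul_sum]
  refine Finset.sum_congr rfl fun ij hij => ?_
  rw [Finset.HasAntidiagonal.mem_antidiagonal] at hij
  rw [coeffExpr_eq, coeffExpr_eq, real_inner_smul_left, real_inner_smul_right, ← hF]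
  have hc : ((n.factorial : ℝ)⁻¹) * ((n.choose ij.1 : ℕ) : ℝ)
      = ((ij.1.factorial : ℝ)⁻¹) * ((ij.2.factorial : ℝ)⁻¹) := by
    have h := Nat.add_choose_mul_factorial_mul_factorial ij.1 ij.2
    rw [hij] at h
    rw [← Nat.choose_symm_of_eq_add hij.symm] at h
    have hpos1 : (ij.1.factorial : ℝ) ≠ 0 := Nat.cast_ne_zero.mpr (Nat.factorial_ne_zero _)
    have hpos2 : (ij.2.factorial : ℝ) ≠ 0 := Nat.cast_ne_zero.mpr (Nat.factorial_ne_zero _)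
    have hposn : (n.factorial : ℝ) ≠ 0 := Nat.cast_ne_zero.mpr (Nat.factorial_ne_zero _)
    field_simp
    exact_mod_cast h
  linear_combination (-(1 / 2 : ℝ) * a * ⟪F ij.1 0, F ij.2 0⟫_ℝ) * hc

end PairingTaylor

/-! ## §7. DATA BRIDGE to the token of record `B3Prop1.VertexKind` (v1.1; row owner's precision) -/

section DataBridge

open Literature.MathematicalPhysics.QuantumFieldTheory.Balaban1983to89.B3Prop1 (VertexKind)

variable (C : ChargeData N) (w : ℝ) (β α τ : HiggsLattice.Site P 0 → ℝ) (φ' : HiggsLattice.ScalarField P 0 N) (k : ℕ)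
  (y : HiggsLattice.Site P k)

/-- **Scalar legs = `VertexKind.scalarLegs = 1`**: (1.13) is homogeneous of degree `VertexKind.v113.scalarLegs` (linear) in
`φ′`. [cite: Balaban1983Higgs3, (1.13) p.413] -/
theorem vertex113_smul_field (c : ℝ) :
    vertex113 C w β (c • φ') k y = c ^ VertexKind.v113.scalarLegs • vertex113 C w β φ' k y := by
  unfold vertex113
  simp only [Pi.smul_apply, map_smul, ← Finset.smul_sum, VertexKind.scalarLegs, pow_one, smul_neg]
  rw [smul_comm]

/-- (1.14) is homogeneous of degree `(VertexKind.v114 n n′).scalarLegs = 1` in `φ′`. [cite: Balaban1983Higgs3, (1.14) p.413] -/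
theorem vertex114_smul_field (c : ℝ) (n n' : ℕ) :
    vertex114 C w β α τ (c • φ') k n n' y = c ^ (VertexKind.v114 n n').scalarLegs • vertex114 C w β α τ φ' k n n' y := by
  unfold vertex114
  simp only [Pi.smul_apply, map_smul, VertexKind.scalarLegs, pow_one]
  rw [neg_smul_smul_sum, neg_smul_smul_sum, Finset.smul_sum]
  refine Finset.sum_congr rfl fun x _ => ?_
  simp only [smul_smul]
  congr 1
  ring

/-- (1.15) is homogeneous of degree `(VertexKind.v115 n n̄).scalarLegs = 1` in `φ′`. [cite: Balaban1983Higgs3, (1.15) p.414] -/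
theorem vertex115_smul_field (c : ℝ) (nbar n : ℕ) :
    vertex115 C w β α τ (c • φ') k nbar n y
      = c ^ (VertexKind.v115 n nbar).scalarLegs • vertex115 C w β α τ φ' k nbar n y := by
  unfold vertex115
  simp only [Pi.smul_apply, map_smul, VertexKind.scalarLegs, pow_one]
  rw [neg_smul_smul_sum, neg_smul_smul_sum, Finset.smul_sum]
  refine Finset.sum_congr rfl fun x _ => ?_
  simp only [smul_smul]
  congr 1
  ring

/-- **A′-legs = `VertexKind.vectorLegs = n`**: (1.14) is homogeneous of degree `(VertexKind.v114 n n′).vectorLegs` in the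
contour functional of `A′` (p. 414 *"All the A′-legs are contracted"*). [cite: Balaban1983Higgs3, (1.14) p.413] -/
theorem vertex114_smul_fluct (c : ℝ) (n n' : ℕ) :
    vertex114 C w β (c • α) τ φ' k n n' y = c ^ (VertexKind.v114 n n').vectorLegs • vertex114 C w β α τ φ' k n n' y := by
  unfold vertex114
  simp only [Pi.smul_apply, smul_eq_mul, mul_pow, VertexKind.vectorLegs]
  rw [neg_smul_smul_sum, neg_smul_smul_sum, Finset.smul_sum]
  refine Finset.sum_congr rfl fun x _ => ?_
  simp only [smul_smul]
  congr 1
  ring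

/-- (1.15) is homogeneous of degree `(VertexKind.v115 n n̄).vectorLegs = n` in the contour functional of `A′`.
[cite: Balaban1983Higgs3, (1.15) p.414] -/
theorem vertex115_smul_fluct (c : ℝ) (nbar n : ℕ) :
    vertex115 C w β (c • α) τ φ' k nbar n y
      = c ^ (VertexKind.v115 n nbar).vectorLegs • vertex115 C w β α τ φ' k nbar n y := by
  unfold vertex115
  simp only [Pi.smul_apply, smul_eq_mul, mul_pow, VertexKind.vectorLegs]
  rw [neg_smul_smul_sum, neg_smul_smul_sum, Finset.smul_sum]
  refine Finset.sum_congr rfl fun x _ => ?_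
  simp only [smul_smul]
  congr 1
  ring

/-- **Ã-legs = `VertexKind.extVectorLegs = n′`** for (1.14): homogeneous of degree `(VertexKind.v114 n n′).extVectorLegs` in
the contour functional of `Ã` (the R-vertex (1.15) is NOT homogeneous in `Ã`: `R_{n̄+1}(qe(L^kε)Ã(Γ))` depends on `Ã`; its
count `n̄ + 1` is the explicit power, `|R_{n̄+1}| ≦ 1` p. 414 being used separately). [cite: Balaban1983Higgs3, (1.14) p.413] -/
theorem vertex114_smul_ext (c : ℝ) (n n' : ℕ) :
    vertex114 C w β α (c • τ) φ' k n n' y = c ^ (VertexKind.v114 n n').extVectorLegs • vertex114 C w β α τ φ' k n n' y := by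
  unfold vertex114
  simp only [Pi.smul_apply, smul_eq_mul, mul_pow, VertexKind.extVectorLegs]
  rw [neg_smul_smul_sum, neg_smul_smul_sum, Finset.smul_sum]
  refine Finset.sum_congr rfl fun x _ => ?_
  simp only [smul_smul]
  congr 1
  ring

/-- **Coupling order `d_v` = `VertexKind.dv`** (p. 420): the explicit power of `e(L^kε)` in (1.14) is
`(VertexKind.v114 n n′).dv = n + n′` (the η-count `etaCount d = d` is print's factor `η^d`, carried here by the weight `w`).
[cite: Balaban1983Higgs3, (1.14) p.413] -/
theorem vertex114_eq_dv (n n' : ℕ) :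
    vertex114 C w β α τ φ' k n n' y
      = -((C.e ^ (VertexKind.v114 n n').dv * (1 / ((n.factorial : ℝ) * n'.factorial)))
          • (w • ∑ x ∈ blockK k y, (α x ^ n * τ x ^ n') • (C.q ^ (n + n')) (C.U 1 (β x) (φ' x)))) := by
  unfold vertex114
  simp only [VertexKind.dv]

/-- The same for (1.15): `dv = n + n̄ + 1`. [cite: Balaban1983Higgs3, (1.15) p.414] -/
theorem vertex115_eq_dv (nbar n : ℕ) :
    vertex115 C w β α τ φ' k nbar n y
      = -((C.e ^ (VertexKind.v115 n nbar).dv * (1 / ((n.factorial : ℝ) * (nbar + 1).factorial)))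
          • (w • ∑ x ∈ blockK k y, (α x ^ n * τ x ^ (nbar + 1))
              • ((C.q ^ (n + nbar + 1) * taylorRemOp nbar ((C.e * τ x) • C.q)) (C.U 1 (β x) (φ' x))))) := by
  unfold vertex115
  simp only [VertexKind.dv]

/-- **Print's side conditions = `VertexKind.Admissible` = the index ranges of `taylorCoeff_avgTerm`**: for `n, n′ ≦ n̄`,
(1.14)_{n,n′} is admissible iff `n + n′ ≧ 1` (the filter of the theorem). [cite: Balaban1983Higgs3, (1.14) p.413] -/
theorem admissible114_iff {nbar n n' : ℕ} (hn : n ≤ nbar) (hn' : n' ∈ Finset.range (nbar + 1)) :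
    (VertexKind.v114 n n').Admissible nbar ↔ 1 ≤ n + n' := by
  rw [Finset.mem_range] at hn'
  simp only [VertexKind.Admissible]
  omega

/-- The R-vertex (1.15)_n of `taylorCoeff_avgTerm` (remainder order `n̄`) is admissible for every `n ≦ n̄`; (1.13) always.
[cite: Balaban1983Higgs3, (1.15) p.414] -/
theorem admissible113_115 {nbar n : ℕ} (hn : n ≤ nbar) :
    VertexKind.v113.Admissible nbar ∧ (VertexKind.v115 n nbar).Admissible nbar := by
  simp only [VertexKind.Admissible]
  exact ⟨trivial, trivial, hn⟩

/-- The catalogue tags of the token: (1.14)/(1.15) are the *"vertices of the form (1.14) and (1.15)"* (`isAveragingVertex`, the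
extra degree summand of (2.1) p. 422), (1.13)–(1.15) are *"of the form (1.13)–(1.15)"*, (1.15) is an R-vertex; no lattice
differentiation. [cite: Balaban1983Higgs3, (2.1) p.422] -/
theorem tags_catalogue (n n' nbar : ℕ) :
    (VertexKind.v114 n n').isAveragingVertex = true ∧ (VertexKind.v115 n nbar).isAveragingVertex = true
      ∧ VertexKind.v113.isAveragingVertex = false ∧ VertexKind.v113.isOfForm1315 = true
      ∧ (VertexKind.v115 n nbar).isRVertex = true ∧ (VertexKind.v114 n n').isRVertex = false
      ∧ (VertexKind.v114 n n').diffCount = 0 := by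
  simp [VertexKind.isAveragingVertex, VertexKind.isOfForm1315, VertexKind.isRVertex, VertexKind.diffCount]

end DataBridge

/-! ## §8. *"and finally we sum over y ∈ T₁^{(k)} ∩ Ω"*: the kernel `t(Ω; φ, φ′)` of the typed (1.4) (v1.2, append-only) -/

section Kernel14

open Literature.MathematicalPhysics.QuantumFieldTheory.Balaban1983to89.B3MultiscaleFields (etaSumK)
open Literature.MathematicalPhysics.QuantumFieldTheory.Balaban1983to89.B3Eq14AuxFunction
open Literature.MathematicalPhysics.QuantumFieldTheory.Balaban1983to89.B3Eq15ChargeDerivative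
open Literature.MathematicalPhysics.QuantumFieldTheory.Balaban1983to89.B1RT (rtKernel rtKernel_eq rtKernel_pos prec)

variable {K : ℕ} (D : Data14 P N K)

/-- The logarithm of the single-site kernel `t_κ(v) = (κ/2π)^{N/2}e^{−½κ|v|²}` (I (2.6)). [cite: Balaban1982Higgs1, (2.6) p.608] -/
theorem log_rtKernel {κ : ℝ} (hκ : 0 < κ) (v : E N) :
    Real.log (rtKernel κ v) = Real.log ((κ / (2 * Real.pi)) ^ ((Module.finrank ℝ (E N) : ℝ) / 2)) + -(κ / 2) * ‖v‖ ^ 2 := by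
  have h1 : 0 < (κ / (2 * Real.pi)) ^ ((Module.finrank ℝ (E N) : ℝ) / 2) := Real.rpow_pos_of_pos (by positivity) _
  rw [rtKernel_eq, Real.log_mul h1.ne' (Real.exp_pos _).ne', Real.log_exp]

/-- **The exponent of the kernel `t(Ω; φ, φ′) = Π_{y∈Ω^{(k)}} t_κ(φ(y) − (Q_k(e′g_k𝒜 + Ã + B̃)φ′)(y))` of the typed (1.4)
(`B3Eq14AuxFunction.Data14.kernel14`, `κ = a_k(L^kη)^{d−2}`) is the SUM OVER `y` of `−½κ|(1.12) + avgTerm(e′)|²** — p. 414: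
*"… and finally we sum over y ∈ T₁^{(k)} ∩ Ω"* — plus the normalization constant. [cite: Balaban1983Higgs3, p.414 (after (1.15))]
[cite: Balaban1982Higgs1, (2.10) p.609] -/
theorem log_kernel14_eq (hκ : 0 < prec (B1.aSeq D.a P.L K) (P.mesh K) P.d) (At Bt : HiggsLattice.VecField P 0)
    (A' : (j : Fin K) → HiggsLattice.VecField P j) (φ : HiggsLattice.ScalarField P K N) (φΩ : ↥D.Ω → E N) (e' : ℝ) :
    Real.log (D.kernel14 (At + Bt) e' A' φ φΩ)
      = (Fintype.card ↥D.Ωk : ℝ)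
          * Real.log ((prec (B1.aSeq D.a P.L K) (P.mesh K) P.d / (2 * Real.pi)) ^ ((Module.finrank ℝ (E N) : ℝ) / 2))
        + ∑ y : ↥D.Ωk, -(1 / 2 : ℝ) * prec (B1.aSeq D.a P.L K) (P.mesh K) P.d
            * ‖vertex112 φ y.1 + avgTerm D.C (((P.L : ℝ) ^ (K * P.d))⁻¹) (fun x => etaSumK Bt K x) (fluctContour D A')
                (fun x => etaSumK At K x) (extendZero D.Ω φΩ) K y.1 e'‖ ^ 2 := by
  rw [Data14.kernel14_eq, Real.log_prod]
  · simp only [log_rtKernel hκ, Finset.sum_add_distrib, Finset.sum_const, Finset.card_univ, nsmul_eq_mul]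
    congr 1
    refine Finset.sum_congr rfl fun y _ => ?_
    rw [sub_eq_add_neg, neg_avgQ14_eq_avgTerm]
    unfold vertex112
    ring
  · exact fun y _ => (rtKernel_pos hκ _).ne'

/-- Each `y`-term of that exponent is smooth in `e′`. [cite: Balaban1983Higgs3, p.414 (after (1.15))] -/
theorem contDiff_kernelTerm (C : ChargeData N) (w a : ℝ) (β α τ : HiggsLattice.Site P 0 → ℝ)
    (φ' : HiggsLattice.ScalarField P 0 N) (k : ℕ) (φ : HiggsLattice.ScalarField P k N) (y : HiggsLattice.Site P k)
    {m : ℕ∞} :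
    ContDiff ℝ m (fun s : ℝ => -(1 / 2 : ℝ) * a * ‖vertex112 φ y + avgTerm C w β α τ φ' k y s‖ ^ 2) :=
  contDiff_const.mul ((contDiff_const.add (contDiff_avgTerm C w β α τ φ' k y)).norm_sq ℝ)

/-- **p. 414, the whole paragraph for the typed kernel: the `e′`-Taylor coefficients of `log t(Ω; φ, φ′)` are the SUMS OVER
`y ∈ Ω^{(k)}` of the pairings of the expressions (1.12)–(1.15)** — for `n ≥ 1`,
`(1/n!)·∂ⁿ_{e′}|₀ log t = Σ_{y∈Ω^{(k)}} (−½κ Σ_{i+j=n}⟨E_i(y), E_j(y)⟩)`, `E_m(y)` = `coeffExpr` at `y` (remainder order `n̄`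
arbitrary), `κ = a_k(L^kη)^{d−2}`. [cite: Balaban1983Higgs3, p.414 (after (1.15))] -/
theorem taylorCoeff_log_kernel14 (hκ : 0 < prec (B1.aSeq D.a P.L K) (P.mesh K) P.d) (At Bt : HiggsLattice.VecField P 0)
    (A' : (j : Fin K) → HiggsLattice.VecField P j) (φ : HiggsLattice.ScalarField P K N) (φΩ : ↥D.Ω → E N)
    (nbar : ℕ) {n : ℕ} (hn : 1 ≤ n) :
    ((n.factorial : ℝ)⁻¹) * iteratedDeriv n (fun e' : ℝ => Real.log (D.kernel14 (At + Bt) e' A' φ φΩ)) 0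
      = ∑ y : ↥D.Ωk, -(1 / 2 : ℝ) * prec (B1.aSeq D.a P.L K) (P.mesh K) P.d
          * ∑ ij ∈ Finset.HasAntidiagonal.antidiagonal n,
              ⟪coeffExpr D.C (((P.L : ℝ) ^ (K * P.d))⁻¹) (fun x => etaSumK Bt K x) (fluctContour D A')
                  (fun x => etaSumK At K x) (extendZero D.Ω φΩ) K y.1 φ nbar ij.1,
                coeffExpr D.C (((P.L : ℝ) ^ (K * P.d))⁻¹) (fun x => etaSumK Bt K x) (fluctContour D A')
                  (fun x => etaSumK At K x) (extendZero D.Ω φΩ) K y.1 φ nbar ij.2⟫_ℝ := by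
  set κ : ℝ := prec (B1.aSeq D.a P.L K) (P.mesh K) P.d with hκdef
  set w : ℝ := ((P.L : ℝ) ^ (K * P.d))⁻¹ with hw
  set β : HiggsLattice.Site P 0 → ℝ := fun x => etaSumK Bt K x with hβ
  set τ : HiggsLattice.Site P 0 → ℝ := fun x => etaSumK At K x with hτ
  set φ' := extendZero D.Ω φΩ with hφ'
  set g : ↥D.Ωk → ℝ → ℝ := fun y s =>
    -(1 / 2 : ℝ) * κ * ‖vertex112 φ y.1 + avgTerm D.C w β (fluctContour D A') τ φ' K y.1 s‖ ^ 2 with hg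
  -- the function is `constant + Σ_y g y`
  have hfun : (fun e' : ℝ => Real.log (D.kernel14 (At + Bt) e' A' φ φΩ))
      = fun e' => (Fintype.card ↥D.Ωk : ℝ) * Real.log ((κ / (2 * Real.pi)) ^ ((Module.finrank ℝ (E N) : ℝ) / 2))
          + (∑ y : ↥D.Ωk, g y) e' := by
    funext e'
    rw [log_kernel14_eq D hκ, Finset.sum_apply]
  rw [hfun, iteratedDeriv_const_add (by omega), iteratedDeriv_sum fun y _ =>
    ((contDiff_kernelTerm D.C w κ β (fluctContour D A') τ φ' K φ y.1 (m := n)).contDiffAt)]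
  rw [Finset.mul_sum]
  refine Finset.sum_congr rfl fun y _ => ?_
  exact pairing_taylorCoeff D.C w β (fluctContour D A') τ φ' K y.1 φ κ nbar n

end Kernel14

end

end Literature.MathematicalPhysics.QuantumFieldTheory.Balaban1983to89.B3Eq114AveragingVertices
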